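import Summits.AtomisticToContinuum.HydrodynamicLimit.Theorems.AnnealedZeroHorizonMeanFluxClosureCollisionalEnergyCurrentClosureB
import Summits.AtomisticToContinuum.HydrodynamicLimit.Theorems.AnnealedZeroHorizonMeanFluxClosureCollisionEnergyExchangeMeanBound
import Summits.AtomisticToContinuum.HydrodynamicLimit.Theorems.AntiMazurCoboundariesShearStressHalfDrudeMarginal
import Literature.Analysis.FluidPDE.HardSphereTranslation
import Literature.MathematicalPhysics.KineticTheory.HardSphereTwoTimePressure
import HarnessLib

/-!
# Stub CE' `stub_collisionalEnergyContactClosure` of crux `MeanFluxClosure`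
# (stmt-AtomisticToContinuum-9256, route AnnealedZeroHorizon, line `registered`): EOS-free part A —
# unconditional integrability of the contact energy current, and its translation covariance

The stub asks that `c S^e_ψ + J^e_ψ − I^e_ψ` be integrable with small mean under the local Gibbs law,
`c = (N+1)⁻¹`, `S^e_ψ` the CONTACT energy current of the time-`t₁` point over `(0, t₂ − t₁]`: the
collision-indexed functional `HardSphereFlow.collisionalTransferFunctional` with the contact kernel
`(i, j, z⁻, z⁺) ↦ ½ Dψ(x_i)(x_i ⊖ x_j) ΔE_i`, `ΔE_i = (|v_i⁺|² − |v_i⁻|²)/2` (Spohn 1991 (3.8) for hard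
spheres), and `J^e_ψ`/`I^e_ψ` the ideal/full enthalpy-flux integrals. The `I^e − J^e` part carries the
hard-sphere equation of state at uncontrolled local packing (open); this file proves the EOS-free facts
about the contact term:

* `integrable_avg_contactEnergyCurrent_flow` — for continuous profiles `a₀, θ₀ > 0`, `u₀`, `0 < σ < 1/2`,
  EVERY `N`, every flow, `0 ≤ t₁ ≤ t₂` and `ψ ∈ C²` (`‖Dψ‖ ≤ L`, `‖D²ψ‖ ≤ C`), `c S^e_ψ ∘ Φ_{t₁}` is
  integrable under `localGibbsLaw σ a₀ u₀ θ₀ N Φ` with `∫ |c S^e_ψ| ≤ (L/2 + C σ_N/4) ∫ Q`,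
  `Q = σ_N c 𝒮ᴱ ∘ Φ_{t₁}` the FLUX functional (`S^e = W^e − Rem`: the two conditional bounds of the CE files
  composed with the unconditional integrability of `𝒮ᴱ`, `integrable_absEnergyJumpFunctional_flow`);
  registered ∀-form `stub_collisionalEnergyContactIntegrable`.
* translation covariance, the input of the equilibrium computation of part B: the torus derivative of a
  translate is the translated derivative (`torusFderiv_comp_add_right`); the contact functional of the
  diagonally translated curve `T_y ∘ γ`, `T_y (x_i, v_i)_i = (x_i + y, v_i)_i`, is the contact functional
  of `γ` for the translated test function `ψ(· + y)` (`contactEnergyFunctional_posShift`: collision times,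
  colliding pairs and velocities are unchanged, `x_i ⊖ x_j` is translation invariant, left limits commute
  with the continuous `T_y`); the collision-indexed functional over `(a, b]` only depends on the curve on
  `(a, ∞)` (`collisionalTransferFunctional_congr_Ioi`); hence along a flow, for good `z` with good
  translate, `S^e_ψ(Φ_{t₁}(T_y z)) = S^e_{ψ(·+y)}(Φ_{t₁} z)` (`contactEnergyFunctional_flow_posShift`, forward
  flow/translation commutation `HardSphereFlow.flow_posShift_of_nonneg` + cocycle), and under the
  translation-invariant homogeneous Gibbs law `E[c S^e_{ψ(·+y)} ∘ Φ_{t₁}]` does not depend on `y`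
  (`integral_avg_contactEnergyCurrent_shift_eq`).

References: H. Spohn, *Large Scale Dynamics of Interacting Particles* (1991), Part I §2.3, §3.2 (3.8).
-/

noncomputable section

namespace Summit.AtomisticToContinuum.HydrodynamicLimit.Theorems

open scoped BigOperators ENNReal Topology InnerProductSpace
open MeasureTheory Set Filter Function
open Literature.MathematicalPhysics.KineticTheory Literature.Analysis.FluidPDE
open Literature.Analysis.FunctionSpaces
open Summit.AtomisticToContinuum.HydrodynamicLimit.Theorems.JParityClosureMomentumModulus
open Summit.AtomisticToContinuum.HydrodynamicLimit.Theorems.JParityClosureEnergyModulus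
open Summit.AtomisticToContinuum.HydrodynamicLimit.Theorems.CollisionalEnergyCurrentClosure
open Summit.AtomisticToContinuum.HydrodynamicLimit.Theorems.CollisionEnergyExchangeMeanBound
open Summit.AtomisticToContinuum.HydrodynamicLimit.Theorems.ShearStressHalfDrudeMarginal

namespace CollisionalEnergyContactClosure

/-! ## Unconditional integrability of the contact energy current -/

/-- **Integrability of the contact energy current at every `N`** (continuous profiles `a₀, θ₀ > 0`,
`u₀`; `0 < σ < 1/2`; `ψ ∈ C²` with `‖Dψ‖ ≤ L`, `‖D²ψ‖ ≤ C`; `0 ≤ t₁ ≤ t₂`): `c S^e_ψ ∘ Φ_{t₁}` is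
integrable under `localGibbsLaw σ a₀ u₀ θ₀ N Φ` and `∫ |c S^e_ψ ∘ Φ_{t₁}| ≤ (L/2 + C σ_N/4) ∫ Q`,
`Q = σ_N c 𝒮ᴱ ∘ Φ_{t₁}` the FLUX functional (`S^e = W^e − (W^e − S^e)`). [folklore] -/
theorem integrable_avg_contactEnergyCurrent_flow {a₀ θ₀ : T3 → ℝ} {u₀ : T3 → V3}
    (ha : Continuous a₀) (hθ : Continuous θ₀) (hu : Continuous u₀) (ha0 : ∀ x, 0 < a₀ x)
    (hθ0 : ∀ x, 0 < θ₀ x) {σ : ℝ} (hσ : 0 < σ) (hσ2 : σ < 1 / 2) {N : ℕ}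
    (Φ : HardSphereFlow (Torus.geometry (Fin 3)) (hsDiameter σ N) (N + 1))
    {ψ : T3 → ℝ} (hψ : Torus.IsContDiff 2 ψ) {L C : ℝ} (hL : ∀ x, ‖Torus.fderiv ψ x‖ ≤ L)
    (hC : ∀ x, ‖Torus.fderiv (Torus.fderiv ψ) x‖ ≤ C) {t₁ t₂ : ℝ} (h₁ : 0 ≤ t₁) (h₁₂ : t₁ ≤ t₂) :
    Integrable (fun z => ((N + 1 : ℕ) : ℝ)⁻¹ * Φ.collisionalTransferFunctional
        (fun (i j : Fin (N + 1)) (pre post : Config (N + 1) (Fin 3) T3) =>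
          2⁻¹ * (Torus.fderiv ψ (post i).1 ((Torus.geometry (Fin 3)).sepVec (post i).1 (post j).1) *
            ((‖(post i).2‖ ^ 2 - ‖(pre i).2‖ ^ 2) / 2))) (Φ.flow t₁ z) (t₂ - t₁))
      (localGibbsLaw σ a₀ u₀ θ₀ N Φ) ∧
    ∫ z, |((N + 1 : ℕ) : ℝ)⁻¹ * Φ.collisionalTransferFunctional
        (fun (i j : Fin (N + 1)) (pre post : Config (N + 1) (Fin 3) T3) =>
          2⁻¹ * (Torus.fderiv ψ (post i).1 ((Torus.geometry (Fin 3)).sepVec (post i).1 (post j).1) *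
            ((‖(post i).2‖ ^ 2 - ‖(pre i).2‖ ^ 2) / 2))) (Φ.flow t₁ z) (t₂ - t₁)|
        ∂localGibbsLaw σ a₀ u₀ θ₀ N Φ ≤
      (L / 2 + C * hsDiameter σ N / 4) * ∫ z, hsDiameter σ N * ((N + 1 : ℕ) : ℝ)⁻¹ *
        Φ.collisionalTransferFunctional
          (fun (i _j : Fin (N + 1)) (pre post : Config (N + 1) (Fin 3) T3) =>
            |‖(post i).2‖ ^ 2 - ‖(pre i).2‖ ^ 2| / 2) (Φ.flow t₁ z) (t₂ - t₁)
        ∂localGibbsLaw σ a₀ u₀ θ₀ N Φ := by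
  have hQ := (integrable_absEnergyJumpFunctional_flow ha hθ hu ha0 hθ0 hσ
    (hσ2.le.trans_eq (by norm_num)) Φ h₁ h₁₂).const_mul (hsDiameter σ N * ((N + 1 : ℕ) : ℝ)⁻¹)
  obtain ⟨hW, hWle⟩ := integrable_avg_energyTransfer_flow_localGibbs σ a₀ θ₀ u₀ N Φ
    (hψ.of_le one_le_two) hL t₁ t₂ hQ
  obtain ⟨hR, hRle⟩ := integral_abs_contactRemainder_localGibbs_le hσ.le hσ2 a₀ θ₀ u₀ N Φ hψ hC
    t₁ t₂ hQ
  have hS : Integrable (fun z => ((N + 1 : ℕ) : ℝ)⁻¹ * Φ.collisionalTransferFunctional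
      (fun (i j : Fin (N + 1)) (pre post : Config (N + 1) (Fin 3) T3) =>
        2⁻¹ * (Torus.fderiv ψ (post i).1 ((Torus.geometry (Fin 3)).sepVec (post i).1 (post j).1) *
          ((‖(post i).2‖ ^ 2 - ‖(pre i).2‖ ^ 2) / 2))) (Φ.flow t₁ z) (t₂ - t₁))
      (localGibbsLaw σ a₀ u₀ θ₀ N Φ) :=
    (hW.sub hR).congr (ae_of_all _ fun z => by simp only [Pi.sub_apply]; ring)
  refine ⟨hS, ?_⟩
  calc _ ≤ ∫ z, |((N + 1 : ℕ) : ℝ)⁻¹ * Φ.energyTransfer ψ (Φ.flow t₁ z) (t₂ - t₁)| +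
        |((N + 1 : ℕ) : ℝ)⁻¹ * (Φ.energyTransfer ψ (Φ.flow t₁ z) (t₂ - t₁) -
          Φ.collisionalTransferFunctional
            (fun (i j : Fin (N + 1)) (pre post : Config (N + 1) (Fin 3) T3) =>
              2⁻¹ * (Torus.fderiv ψ (post i).1
                ((Torus.geometry (Fin 3)).sepVec (post i).1 (post j).1) *
                ((‖(post i).2‖ ^ 2 - ‖(pre i).2‖ ^ 2) / 2))) (Φ.flow t₁ z) (t₂ - t₁))|
          ∂localGibbsLaw σ a₀ u₀ θ₀ N Φ := by
        refine integral_mono hS.abs (hW.abs.add hR.abs) fun z => ?_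
        dsimp only
        rw [show ∀ c w s : ℝ, c * s = c * w - c * (w - s) from fun c w s => by ring]
        exact abs_sub _ _
    _ = _ := integral_add hW.abs hR.abs
    _ ≤ _ := add_le_add hWle hRle
    _ = _ := by ring

/-- **Registered ∀-form companion**: the bound of `integrable_avg_contactEnergyCurrent_flow` with the
second-derivative bound produced from `ψ ∈ C²` (compact torus). [folklore] -/
theorem integrable_avg_contactEnergyCurrent_flow' {a₀ θ₀ : T3 → ℝ} {u₀ : T3 → V3}
    (ha : Continuous a₀) (hθ : Continuous θ₀) (hu : Continuous u₀) (ha0 : ∀ x, 0 < a₀ x)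
    (hθ0 : ∀ x, 0 < θ₀ x) {σ : ℝ} (hσ : 0 < σ) (hσ2 : σ < 1 / 2) {N : ℕ}
    (Φ : HardSphereFlow (Torus.geometry (Fin 3)) (hsDiameter σ N) (N + 1))
    {ψ : T3 → ℝ} (hψ : Torus.IsContDiff 2 ψ) {t₁ t₂ : ℝ} (h₁ : 0 ≤ t₁) (h₁₂ : t₁ ≤ t₂) :
    Integrable (fun z => ((N + 1 : ℕ) : ℝ)⁻¹ * Φ.collisionalTransferFunctional
        (fun (i j : Fin (N + 1)) (pre post : Config (N + 1) (Fin 3) T3) =>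
          2⁻¹ * (Torus.fderiv ψ (post i).1 ((Torus.geometry (Fin 3)).sepVec (post i).1 (post j).1) *
            ((‖(post i).2‖ ^ 2 - ‖(pre i).2‖ ^ 2) / 2))) (Φ.flow t₁ z) (t₂ - t₁))
      (localGibbsLaw σ a₀ u₀ θ₀ N Φ) := by
  obtain ⟨L, -, hL⟩ := exists_fderiv_le (hψ.of_le one_le_two)
  obtain ⟨C, -, hC⟩ := exists_fderiv_fderiv_le hψ
  exact (integrable_avg_contactEnergyCurrent_flow ha hθ hu ha0 hθ0 hσ hσ2 Φ hψ hL hC h₁ h₁₂).1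

/-! ## Translation covariance of the contact energy current -/

variable {d : Type*} [Fintype d]

omit [Fintype d] in
/-- **The torus derivative of a translate is the translated derivative**:
`D(f(· + y))(x) = Df(x + y)` (the two re-centred lifts coincide). [folklore] -/
theorem torusFderiv_comp_add_right {F : Type*} [NormedAddCommGroup F] [NormedSpace ℝ F]
    (f : UnitAddTorus d → F) (y x : UnitAddTorus d) :
    Torus.fderiv (fun x' => f (x' + y)) x = Torus.fderiv f (x + y) := by
  have hF : (fun v : EuclideanSpace ℝ d => f (x + Torus.proj v + y)) =
      fun v => f (x + y + Torus.proj v) := funext fun v => by rw [add_right_comm]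
  show fderiv ℝ (fun v : EuclideanSpace ℝ d => f (x + Torus.proj v + y)) 0 =
    fderiv ℝ (fun v : EuclideanSpace ℝ d => f (x + y + Torus.proj v)) 0
  rw [hF]

variable {ε : ℝ} {N : ℕ} {γ : ℝ → Config N d (UnitAddTorus d)}

/-- **Pathwise translation covariance of the contact energy current.** For a hard-sphere trajectory
`γ` on `𝕋ᵈ` and `y ∈ 𝕋ᵈ`, the contact functional (kernel `½ Dψ(x_i)(x_i ⊖ x_j) ΔE_i`) of the
translated curve `t ↦ T_y (γ t)` over `(a, b]` equals the contact functional of `γ` for the translated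
test function `ψ(· + y)`: collision times (`collisionTimes_posShift`), colliding pairs
(`posShift_mem_contactSet_iff`) and velocities are unchanged, `x_i ⊖ x_j` is translation invariant
(`Torus.geometry_sepVec_add_right`), left limits commute with the continuous `T_y`, and
`D(ψ(· + y))(x_i) = Dψ(x_i + y)`. [folklore] -/
theorem contactEnergyFunctional_posShift (h : IsHardSphereTrajectory (Torus.geometry d) ε N γ)
    (ψ : UnitAddTorus d → ℝ) (y : UnitAddTorus d) (a b : ℝ) :
    collisionalTransferFunctional (Torus.geometry d) ε
        (fun (i j : Fin N) (pre post : Config N d (UnitAddTorus d)) =>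
          2⁻¹ * (Torus.fderiv ψ (post i).1 ((Torus.geometry d).sepVec (post i).1 (post j).1) *
            ((‖(post i).2‖ ^ 2 - ‖(pre i).2‖ ^ 2) / 2)))
        (fun t => (fun i => ((γ t i).1 + y, (γ t i).2) : Config N d (UnitAddTorus d))) a b =
      collisionalTransferFunctional (Torus.geometry d) ε
        (fun (i j : Fin N) (pre post : Config N d (UnitAddTorus d)) =>
          2⁻¹ * (Torus.fderiv (fun x => ψ (x + y)) (post i).1
            ((Torus.geometry d).sepVec (post i).1 (post j).1) *
            ((‖(post i).2‖ ^ 2 - ‖(pre i).2‖ ^ 2) / 2))) γ a b := by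
  have hG : ∀ x : UnitAddTorus d, Continuous ((Torus.geometry d).translate x) := fun x =>
    continuous_const.add Torus.continuous_proj
  rw [collisionalTransferFunctional_def, collisionalTransferFunctional_def, collisionTimes_posShift]
  refine finsum_mem_congr rfl fun t _ => ?_
  -- colliding pairs are unchanged by the translation
  have hP : collidingPairs (Torus.geometry d) ε
      (fun i => ((γ t i).1 + y, (γ t i).2) : Config N d (UnitAddTorus d)) =
      collidingPairs (Torus.geometry d) ε (γ t) := by
    ext p
    simp only [mem_collidingPairs, posShift_mem_contactSet_iff]
  -- left limits commute with the (continuous) translation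
  have hL : leftLim (fun t => (fun i => ((γ t i).1 + y, (γ t i).2) : Config N d (UnitAddTorus d))) t =
      fun i => ((leftLim γ t i).1 + y, (leftLim γ t i).2) :=
    leftLim_eq_of_tendsto
      (((continuous_posShift y).tendsto (leftLim γ t)).comp (h.tendsto_leftLim hG t))
  rw [hP, hL]
  refine Finset.sum_congr rfl fun p _ => ?_
  dsimp only
  rw [Torus.geometry_sepVec_add_right, torusFderiv_comp_add_right]

/-- **Locality of collision-indexed functionals in the curve**: the functional over `(a, b]` of a curve
`γ'` that agrees with a hard-sphere trajectory `γ` on `(a, ∞)` equals that of `γ` (collision times in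
`(a, b]`, colliding pairs and post-collisional values are read off `(a, b]`, and the left limit at
`t > a` only depends on the curve on `(a, t)`; Hausdorff position space, continuous translations).
[folklore] -/
theorem collisionalTransferFunctional_congr_Ioi {X : Type*} [TopologicalSpace X] [T2Space X]
    {G : Geometry d X} {M : Type*} [AddCommMonoid M] {γ₀ γ' : ℝ → Config N d X}
    (h : IsHardSphereTrajectory G ε N γ₀) (hG : ∀ x : X, Continuous (G.translate x)) {a : ℝ}
    (heq : EqOn γ' γ₀ (Ioi a)) (g : Fin N → Fin N → Config N d X → Config N d X → M) (b : ℝ) :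
    collisionalTransferFunctional G ε g γ' a b = collisionalTransferFunctional G ε g γ₀ a b := by
  rw [collisionalTransferFunctional_def, collisionalTransferFunctional_def]
  have hT : collisionTimes G ε γ' ∩ Ioc a b = collisionTimes G ε γ₀ ∩ Ioc a b := by
    ext t
    simp only [mem_inter_iff, mem_collisionTimes]
    constructor
    · rintro ⟨⟨i, j, hij, hc⟩, ht⟩
      exact ⟨⟨i, j, hij, by rwa [heq ht.1] at hc⟩, ht⟩
    · rintro ⟨⟨i, j, hij, hc⟩, ht⟩
      exact ⟨⟨i, j, hij, by rwa [← heq ht.1] at hc⟩, ht⟩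
  rw [hT]
  refine finsum_mem_congr rfl fun t ht => ?_
  have hat : a < t := ht.2.1
  have hev : γ₀ =ᶠ[𝓝[<] t] γ' :=
    mem_of_superset (Ioo_mem_nhdsLT hat) fun s hs => (heq hs.1).symm
  have hl : leftLim γ' t = leftLim γ₀ t :=
    leftLim_eq_of_tendsto ((h.tendsto_leftLim hG t).congr' hev)
  rw [hl, heq hat]

/-- **Translation covariance of the contact energy current along a flow.** On `𝕋³`, for a good datum
`z` whose translate `T_y z` is good and `0 ≤ t₁ ≤ t₂`:
`S^e_ψ(Φ_{t₁}(T_y z); (0, t₂ − t₁]) = S^e_{ψ(·+y)}(Φ_{t₁} z; (0, t₂ − t₁])` — cocycle over the windows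
from `0`, forward commutation `Φ_s ∘ T_y = T_y ∘ Φ_s` (`s ≥ 0`, `HardSphereFlow.flow_posShift_of_nonneg`),
locality on `(0, ∞)` and the pathwise covariance. [folklore] -/
theorem contactEnergyFunctional_flow_posShift {ε : ℝ} {n : ℕ}
    (Φ : HardSphereFlow (Torus.geometry (Fin 3)) ε n) (ψ : T3 → ℝ) (y : T3)
    {z : Config n (Fin 3) T3} (hz : z ∈ Φ.good)
    (hzy : (fun i => ((z i).1 + y, (z i).2) : Config n (Fin 3) T3) ∈ Φ.good)
    {t₁ t₂ : ℝ} (h₁ : 0 ≤ t₁) (h₁₂ : t₁ ≤ t₂) :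
    Φ.collisionalTransferFunctional
        (fun (i j : Fin n) (pre post : Config n (Fin 3) T3) =>
          2⁻¹ * (Torus.fderiv ψ (post i).1 ((Torus.geometry (Fin 3)).sepVec (post i).1 (post j).1) *
            ((‖(post i).2‖ ^ 2 - ‖(pre i).2‖ ^ 2) / 2)))
        (Φ.flow t₁ (fun i => ((z i).1 + y, (z i).2))) (t₂ - t₁) =
      Φ.collisionalTransferFunctional
        (fun (i j : Fin n) (pre post : Config n (Fin 3) T3) =>
          2⁻¹ * (Torus.fderiv (fun x => ψ (x + y)) (post i).1
            ((Torus.geometry (Fin 3)).sepVec (post i).1 (post j).1) *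
            ((‖(post i).2‖ ^ 2 - ‖(pre i).2‖ ^ 2) / 2))) (Φ.flow t₁ z) (t₂ - t₁) := by
  have hG : ∀ x : T3, Continuous ((Torus.geometry (Fin 3)).translate x) := fun x =>
    continuous_const.add Torus.continuous_proj
  have htraj := Φ.isTrajectory z hz
  -- the two curves `s ↦ Φ_s (T_y z)` and `s ↦ T_y (Φ_s z)` agree on `(0, ∞)`
  have heq : EqOn (fun s => Φ.flow s (fun i => ((z i).1 + y, (z i).2)))
      (fun s => (fun i => ((Φ.flow s z i).1 + y, (Φ.flow s z i).2) : Config n (Fin 3) T3)) (Ioi 0) :=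
    fun s hs => Φ.flow_posShift_of_nonneg y hz hzy (le_of_lt hs)
  have key : ∀ t : ℝ, Φ.collisionalTransferFunctional
      (fun (i j : Fin n) (pre post : Config n (Fin 3) T3) =>
        2⁻¹ * (Torus.fderiv ψ (post i).1 ((Torus.geometry (Fin 3)).sepVec (post i).1 (post j).1) *
          ((‖(post i).2‖ ^ 2 - ‖(pre i).2‖ ^ 2) / 2)))
        (fun i => ((z i).1 + y, (z i).2)) t =
      Φ.collisionalTransferFunctional
        (fun (i j : Fin n) (pre post : Config n (Fin 3) T3) =>
          2⁻¹ * (Torus.fderiv (fun x => ψ (x + y)) (post i).1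
            ((Torus.geometry (Fin 3)).sepVec (post i).1 (post j).1) *
            ((‖(post i).2‖ ^ 2 - ‖(pre i).2‖ ^ 2) / 2))) z t := fun t => by
    rw [HardSphereFlow.collisionalTransferFunctional_eq, HardSphereFlow.collisionalTransferFunctional_eq,
      collisionalTransferFunctional_congr_Ioi (htraj.posShift y) hG heq _ t]
    exact contactEnergyFunctional_posShift htraj ψ y 0 t
  rw [collisionalTransferFunctional_flow_eq_sub Φ _ hzy h₁ h₁₂,
    collisionalTransferFunctional_flow_eq_sub Φ _ hz h₁ h₁₂, key, key]

/-- **Shift invariance of the mean contact energy current in equilibrium.** For constant profiles the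
local Gibbs law `G_N` is invariant under the diagonal translations `T_y` and carried by good data with
good translate, so `E_G[c S^e_{ψ(·+y)} ∘ Φ_{t₁}] = E_G[c S^e_ψ ∘ Φ_{t₁}]` for every `y ∈ 𝕋³`
(`0 ≤ t₁ ≤ t₂`; no integrability needed). [folklore] -/
theorem integral_avg_contactEnergyCurrent_shift_eq {σ : ℝ} (a θ : ℝ) (u : V3) {N : ℕ}
    (Φ : HardSphereFlow (Torus.geometry (Fin 3)) (hsDiameter σ N) (N + 1)) (ψ : T3 → ℝ) (y : T3)
    {t₁ t₂ : ℝ} (h₁ : 0 ≤ t₁) (h₁₂ : t₁ ≤ t₂) :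
    ∫ z, ((N + 1 : ℕ) : ℝ)⁻¹ * Φ.collisionalTransferFunctional
        (fun (i j : Fin (N + 1)) (pre post : Config (N + 1) (Fin 3) T3) =>
          2⁻¹ * (Torus.fderiv (fun x => ψ (x + y)) (post i).1
            ((Torus.geometry (Fin 3)).sepVec (post i).1 (post j).1) *
            ((‖(post i).2‖ ^ 2 - ‖(pre i).2‖ ^ 2) / 2))) (Φ.flow t₁ z) (t₂ - t₁)
        ∂(localGibbsLaw σ (fun _ => a) (fun _ => u) (fun _ => θ) N Φ) =
      ∫ z, ((N + 1 : ℕ) : ℝ)⁻¹ * Φ.collisionalTransferFunctional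
        (fun (i j : Fin (N + 1)) (pre post : Config (N + 1) (Fin 3) T3) =>
          2⁻¹ * (Torus.fderiv ψ (post i).1 ((Torus.geometry (Fin 3)).sepVec (post i).1 (post j).1) *
            ((‖(post i).2‖ ^ 2 - ‖(pre i).2‖ ^ 2) / 2))) (Φ.flow t₁ z) (t₂ - t₁)
        ∂(localGibbsLaw σ (fun _ => a) (fun _ => u) (fun _ => θ) N Φ) := by
  have hac := localGibbsLaw_absolutelyContinuous σ (fun _ => a) (fun _ => u) (fun _ => θ) N Φ
  have hgood : ∀ᵐ z ∂(localGibbsLaw σ (fun _ => a) (fun _ => u) (fun _ => θ) N Φ), z ∈ Φ.good :=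
    hac.ae_le Φ.ae_mem_good
  have hgood' : ∀ᵐ z ∂(localGibbsLaw σ (fun _ => a) (fun _ => u) (fun _ => θ) N Φ),
      (fun i => ((z i).1 + y, (z i).2) : Config (N + 1) (Fin 3) T3) ∈ Φ.good :=
    hac.ae_le (Φ.ae_posShift_mem_good y)
  calc _ = ∫ z, ((N + 1 : ℕ) : ℝ)⁻¹ * Φ.collisionalTransferFunctional
        (fun (i j : Fin (N + 1)) (pre post : Config (N + 1) (Fin 3) T3) =>
          2⁻¹ * (Torus.fderiv ψ (post i).1 ((Torus.geometry (Fin 3)).sepVec (post i).1 (post j).1) *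
            ((‖(post i).2‖ ^ 2 - ‖(pre i).2‖ ^ 2) / 2)))
        (Φ.flow t₁ (fun i => ((z i).1 + y, (z i).2))) (t₂ - t₁)
        ∂(localGibbsLaw σ (fun _ => a) (fun _ => u) (fun _ => θ) N Φ) := by
        refine integral_congr_ae ?_
        filter_upwards [hgood, hgood'] with z hz hzy
        rw [contactEnergyFunctional_flow_posShift Φ ψ y hz hzy h₁ h₁₂]
    _ = _ := integral_comp_posShift_localGibbsLaw_const σ a θ u N Φ y
          (fun z => ((N + 1 : ℕ) : ℝ)⁻¹ * Φ.collisionalTransferFunctional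
            (fun (i j : Fin (N + 1)) (pre post : Config (N + 1) (Fin 3) T3) =>
              2⁻¹ * (Torus.fderiv ψ (post i).1
                ((Torus.geometry (Fin 3)).sepVec (post i).1 (post j).1) *
                ((‖(post i).2‖ ^ 2 - ‖(pre i).2‖ ^ 2) / 2))) (Φ.flow t₁ z) (t₂ - t₁))

end CollisionalEnergyContactClosure

/-- **Registered-stub form (CE'-int)** of `CollisionalEnergyContactClosure.integrable_avg_contactEnergyCurrent_flow`:
the contact energy current `c S^e_ψ ∘ Φ_{t₁}` of stub CE' is integrable under the local Gibbs law at EVERY `N`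
(continuous positive profiles, `0 < σ < 1/2`, `ψ ∈ C²`), with `∫ |c S^e_ψ| ≤ (L/2 + C σ_N/4) ∫ Q`. [folklore] -/
theorem stub_collisionalEnergyContactIntegrable : ∀ (a₀ θ₀ : Literature.MathematicalPhysics.KineticTheory.T3 → ℝ) (u₀ : Literature.MathematicalPhysics.KineticTheory.T3 → Literature.MathematicalPhysics.KineticTheory.V3), Continuous a₀ → Continuous θ₀ → Continuous u₀ → (∀ x, 0 < a₀ x) → (∀ x, 0 < θ₀ x) → ∀ (σ : ℝ), 0 < σ → σ < 1 / 2 → ∀ (N : ℕ) (Φ : Literature.Analysis.FluidPDE.HardSphereFlow (Literature.Analysis.FluidPDE.Torus.geometry (Fin 3)) (Literature.MathematicalPhysics.KineticTheory.hsDiameter σ N) (N + 1)) (ψ : Literature.MathematicalPhysics.KineticTheory.T3 → ℝ), Literature.Analysis.FunctionSpaces.Torus.IsContDiff 2 ψ → ∀ (L C : ℝ), (∀ x, ‖Literature.Analysis.FunctionSpaces.Torus.fderiv ψ x‖ ≤ L) → (∀ x, ‖Literature.Analysis.FunctionSpaces.Torus.fderiv (Literature.Analysis.FunctionSpaces.Torus.fderiv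 ψ) x‖ ≤ C) → ∀ (t₁ t₂ : ℝ), 0 ≤ t₁ → t₁ ≤ t₂ → MeasureTheory.Integrable (fun z => ((N + 1 : ℕ) : ℝ)⁻¹ * Φ.collisionalTransferFunctional (fun (i j : Fin (N + 1)) (pre post : Literature.Analysis.FluidPDE.Config (N + 1) (Fin 3) Literature.MathematicalPhysics.KineticTheory.T3) => 2⁻¹ * (Literature.Analysis.FunctionSpaces.Torus.fderiv ψ (post i).1 ((Literature.Analysis.FluidPDE.Torus.geometry (Fin 3)).sepVec (post i).1 (post j).1) * ((‖(post i).2‖ ^ 2 - ‖(pre i).2‖ ^ 2) / 2))) (Φ.flow t₁ z) (t₂ - t₁)) (Literature.MathematicalPhysics.KineticTheory.localGibbsLaw σ a₀ u₀ θ₀ N Φ) ∧ ∫ z, |((N + 1 : ℕ) : ℝ)⁻¹ * Φ.collisionalTransferFunctional (fun (i j : Fin (N + 1)) (pre post : Literature.Analysis.FluidPDE.Config (N + 1) (Fin 3) Literature.MathematicalPhysics.KineticTheory.T3) => 2⁻¹ * (Literature.Analysis.FunctionSpaces.Torus.fderiv ψ (post i).1 ((Literature.Analysis.FluidPDE.Torus.geometry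 (Fin 3)).sepVec (post i).1 (post j).1) * ((‖(post i).2‖ ^ 2 - ‖(pre i).2‖ ^ 2) / 2))) (Φ.flow t₁ z) (t₂ - t₁)| ∂Literature.MathematicalPhysics.KineticTheory.localGibbsLaw σ a₀ u₀ θ₀ N Φ ≤ (L / 2 + C * Literature.MathematicalPhysics.KineticTheory.hsDiameter σ N / 4) * ∫ z, Literature.MathematicalPhysics.KineticTheory.hsDiameter σ N * ((N + 1 : ℕ) : ℝ)⁻¹ * Φ.collisionalTransferFunctional (fun (i _j : Fin (N + 1)) (pre post : Literature.Analysis.FluidPDE.Config (N + 1) (Fin 3) Literature.MathematicalPhysics.KineticTheory.T3) => |‖(post i).2‖ ^ 2 - ‖(pre i).2‖ ^ 2| / 2) (Φ.flow t₁ z) (t₂ - t₁) ∂Literature.MathematicalPhysics.KineticTheory.localGibbsLaw σ a₀ u₀ θ₀ N Φ :=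
  fun _a₀ _θ₀ _u₀ ha hθ hu ha0 hθ0 _σ hσ hσ2 _N Φ _ψ hψ _L _C hL hC _t₁ _t₂ h₁ h₁₂ =>
    CollisionalEnergyContactClosure.integrable_avg_contactEnergyCurrent_flow ha hθ hu ha0 hθ0 hσ hσ2 Φ hψ
      hL hC h₁ h₁₂

end Summit.AtomisticToContinuum.HydrodynamicLimit.Theorems

end
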